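/-
  HodgeLocusCensusInclusionRankFiltration.lean — pub-hlocus ENGINE B (ivhs-2, gen 55), PROBE 15a (successor material, R-L572 (b)/(d); probe-only, NOT filed).
  certified instances and evidence bearing on the general Hodge conjecture; no claim.

  KERNEL RANK THEOREMS (evidence class; linear algebra of inclusion matrices; nothing about HC). WILSON'S p-RANK FORMULA FROM A LIFTING HYPOTHESIS.
  ABSTRACT FORM (section `Abstract`): for linear maps ψ k i : U i → U k with ψ_{k←t} ∘ ψ_{t←n} = C(n−k,t−k) • ψ_{k←n} (k ≤ t ≤ n), ψ_{i←i} = id,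
  dim U i = C(m,i) (i ≤ m), and the LIFTING HYPOTHESIS H : ⋂_{k<j} ker ψ_{k←j} ≤ ψ_{j←i} (⋂_{k<j} ker ψ_{k←i}) (j ≤ i, i + j ≤ m), the range of
  ψ_{t←n} (t ≤ n, t + n ≤ m) has dimension Σ_{j ≤ t, C(n−j,t−j) ≠ 0 in K} (C(m,j) − C(m,j−1)) (`finrank_range_eq_sum`): filter range ψ_{t←n} by the
  kernel filtration F_j = ⋂_{k<j} ker ψ_{k←t} (`finrank_eq_sum_finrank_map`); the j-th graded piece is 0 when C(n−j,t−j) = 0 in K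
  (`map_inf_eq_bot_of_cast_choose_eq_zero`) and is all of S_j := ⋂_{k<j} ker ψ_{k←j} otherwise (`map_inf_ker_eq`, using H); dim S_j = C(m,j) − C(m,j−1)
  by telescoping (`sum_finrank_inf_ker_eq`, `finrank_inf_ker_eq`).
  CONCRETE FORM (section `Concrete`, `rank_incl_eq_sum_of_lift`): the inclusion matrices W_{k,i}(α) S T = [S ⊆ T] (#S = k, #T = i; the W-convention of
  anchors 204/230/231/271) satisfy W_{k,t} W_{t,n} = C(n−k,t−k) W_{k,n} (`incl_mul_incl`, Wilson's (3.1), via `card_filter_subset_subset`), so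
  H ⇒ rank_p W_{t,n}(α) = Σ_{j ≤ t, p ∤ C(n−j,t−j)} (C(#α,j) − C(#α,j−1)) for [CharP K p], t ≤ n, t + n ≤ #α.  H is DISCHARGED in
  `…InclusionRankLift` (PROBE 15d), which proves the formula unconditionally: R. M. Wilson, A diagonal form for the incidence matrices of t-subsets
  vs. k-subsets, Europ. J. Combin. 11 (1990) 609–615, Theorem 1 [cite: Wilson1990, Thm 1].
  15 theorems, 0 defs; imports Mathlib only; no sorries, axioms, instances or notation.
-/
import Mathlib

set_option linter.dupNamespace false
set_option autoImplicit false

namespace Summit.HodgeConjecture.HodgeConjecture.HodgeLocus.Census.InclusionRankFiltration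

open Module

/-! ## Part A — the kernel filtration of an abstract inclusion system -/

section Abstract

variable (K : Type*) [Field K] {U : ℕ → Type*} [∀ k, AddCommGroup (U k)] [∀ k, Module K (U k)]
  (ψ : ∀ k i : ℕ, U i →ₗ[K] U k)

/-- ONE STEP of the kernel filtration: `dim Q = dim ψ_j(Q) + dim (Q ⊓ ker ψ_j)`. -/
theorem finrank_eq_finrank_map_add [∀ k, FiniteDimensional K (U k)] (i j : ℕ) (Q : Submodule K (U i)) :
    finrank K Q = finrank K (Q.map (ψ j i)) + finrank K ↥(Q ⊓ LinearMap.ker (ψ j i)) := by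
  have h1 := LinearMap.finrank_range_add_finrank_ker ((ψ j i).domRestrict Q)
  rw [LinearMap.range_domRestrict, LinearMap.ker_domRestrict] at h1
  have h2 : finrank K (Submodule.comap Q.subtype (LinearMap.ker (ψ j i))) =
      finrank K ↥(Q ⊓ LinearMap.ker (ψ j i)) := by
    rw [← Submodule.finrank_map_subtype_eq Q (Submodule.comap Q.subtype (LinearMap.ker (ψ j i))),
      Submodule.map_comap_subtype]
  omega

/-- **THE FILTRATION COUNT**: if `ψ_{i←i}` is one-to-one, then for every subspace `P ≤ U_i`,
`dim P = Σ_{j ≤ i} dim ψ_{j←i}(P ⊓ ⋂_{k<j} ker ψ_{k←i})`. -/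
theorem finrank_eq_sum_finrank_map [∀ k, FiniteDimensional K (U k)] (i : ℕ) (hi : LinearMap.ker (ψ i i) = ⊥)
    (P : Submodule K (U i)) :
    finrank K P = ∑ j ∈ Finset.range (i + 1),
      finrank K ((P ⊓ (Finset.range j).inf (fun k => LinearMap.ker (ψ k i))).map (ψ j i)) := by
  have tel : ∀ j : ℕ, finrank K P = (∑ j' ∈ Finset.range j,
      finrank K ((P ⊓ (Finset.range j').inf (fun k => LinearMap.ker (ψ k i))).map (ψ j' i))) +
      finrank K ↥(P ⊓ (Finset.range j).inf (fun k => LinearMap.ker (ψ k i))) := by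
    intro j
    induction j with
    | zero => rw [Finset.sum_range_zero, Finset.range_zero, Finset.inf_empty, inf_top_eq, zero_add]
    | succ j ih =>
      rw [Finset.sum_range_succ, ih, add_assoc, add_left_cancel_iff,
        finrank_eq_finrank_map_add K ψ i j (P ⊓ (Finset.range j).inf (fun k => LinearMap.ker (ψ k i))),
        add_left_cancel_iff, Finset.range_add_one, Finset.inf_insert, ← inf_assoc, inf_right_comm]
  rw [tel (i + 1), add_eq_left, Submodule.finrank_eq_zero, eq_bot_iff]
  intro x hx
  rw [Finset.range_add_one, Finset.inf_insert] at hx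
  have hx' : x ∈ LinearMap.ker (ψ i i) := (Submodule.mem_inf.mp (Submodule.mem_inf.mp hx).2).1
  rw [hi] at hx'
  exact hx'

/-- VANISHING: if `C(n−j, t−j) = 0` in `K` then `ψ_{j←t}` kills the range of `ψ_{t←n}` (and every part of it). -/
theorem map_inf_eq_bot_of_cast_choose_eq_zero
    (hcomp : ∀ k t n : ℕ, k ≤ t → t ≤ n → (ψ k t) ∘ₗ (ψ t n) = (((n - k).choose (t - k) : ℕ) : K) • ψ k n)
    (j t n : ℕ) (hjt : j ≤ t) (htn : t ≤ n)
    (h0 : (((n - j).choose (t - j) : ℕ) : K) = 0) (F : Submodule K (U t)) :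
    (LinearMap.range (ψ t n) ⊓ F).map (ψ j t) = ⊥ := by
  rw [eq_bot_iff]
  rintro y ⟨x, ⟨⟨z, rfl⟩, -⟩, rfl⟩
  rw [Submodule.mem_bot, ← LinearMap.comp_apply, hcomp j t n hjt htn, h0, zero_smul, LinearMap.zero_apply]

/-- INTO THE SPECHT KERNEL: `ψ_{j←i}(⋂_{k<j} ker ψ_{k←i}) ≤ ⋂_{k<j} ker ψ_{k←j}` for `j ≤ i`. -/
theorem map_inf_ker_le
    (hcomp : ∀ k t n : ℕ, k ≤ t → t ≤ n → (ψ k t) ∘ₗ (ψ t n) = (((n - k).choose (t - k) : ℕ) : K) • ψ k n)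
    (j i : ℕ) (hji : j ≤ i) :
    ((Finset.range j).inf (fun k => LinearMap.ker (ψ k i))).map (ψ j i) ≤
      (Finset.range j).inf (fun k => LinearMap.ker (ψ k j)) := by
  rintro y ⟨x, hx, rfl⟩
  rw [SetLike.mem_coe, Submodule.mem_finsetInf] at hx
  rw [Submodule.mem_finsetInf]
  intro k hk
  have hkj : k ≤ j := (Finset.mem_range.mp hk).le
  rw [LinearMap.mem_ker, ← LinearMap.comp_apply, hcomp k j i hkj hji, LinearMap.smul_apply,
    LinearMap.mem_ker.mp (hx k hk), smul_zero]

/-- LOWER PIECE: if `C(n−j,t−j) ≠ 0` in `K` then `ψ_{j←n}(⋂_{k<j} ker ψ_{k←n}) ≤ ψ_{j←t}(range ψ_{t←n} ⊓ ⋂_{k<j} ker ψ_{k←t})`. -/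
theorem map_inf_ker_le_map_range_inf
    (hcomp : ∀ k t n : ℕ, k ≤ t → t ≤ n → (ψ k t) ∘ₗ (ψ t n) = (((n - k).choose (t - k) : ℕ) : K) • ψ k n)
    (j t n : ℕ) (hjt : j ≤ t) (htn : t ≤ n)
    (h0 : (((n - j).choose (t - j) : ℕ) : K) ≠ 0) :
    ((Finset.range j).inf (fun k => LinearMap.ker (ψ k n))).map (ψ j n) ≤
      (LinearMap.range (ψ t n) ⊓ (Finset.range j).inf (fun k => LinearMap.ker (ψ k t))).map (ψ j t) := by
  rintro y ⟨x, hx, rfl⟩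
  rw [SetLike.mem_coe, Submodule.mem_finsetInf] at hx
  have hmem : ψ t n x ∈ LinearMap.range (ψ t n) ⊓ (Finset.range j).inf (fun k => LinearMap.ker (ψ k t)) := by
    refine ⟨LinearMap.mem_range_self _ _, ?_⟩
    rw [SetLike.mem_coe, Submodule.mem_finsetInf]
    intro k hk
    have hkt : k ≤ t := ((Finset.mem_range.mp hk).le).trans hjt
    rw [LinearMap.mem_ker, ← LinearMap.comp_apply, hcomp k t n hkt htn, LinearMap.smul_apply,
      LinearMap.mem_ker.mp (hx k hk), smul_zero]
  have himg : ψ j t (ψ t n x) = (((n - j).choose (t - j) : ℕ) : K) • ψ j n x := by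
    rw [← LinearMap.comp_apply, hcomp j t n hjt htn, LinearMap.smul_apply]
  have h1 : (((n - j).choose (t - j) : ℕ) : K) • ψ j n x ∈
      (LinearMap.range (ψ t n) ⊓ (Finset.range j).inf (fun k => LinearMap.ker (ψ k t))).map (ψ j t) :=
    ⟨ψ t n x, hmem, himg⟩
  have h2 := Submodule.smul_mem _ ((((n - j).choose (t - j) : ℕ) : K))⁻¹ h1
  rwa [smul_smul, inv_mul_cancel₀ h0, one_smul] at h2

/-- Under the LIFTING HYPOTHESIS `H` the filtration images ARE the Specht kernels:
`ψ_{j←i}(⋂_{k<j} ker ψ_{k←i}) = ⋂_{k<j} ker ψ_{k←j}` for `j ≤ i`, `i + j ≤ m`. -/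
theorem map_inf_ker_eq
    (hcomp : ∀ k t n : ℕ, k ≤ t → t ≤ n → (ψ k t) ∘ₗ (ψ t n) = (((n - k).choose (t - k) : ℕ) : K) • ψ k n)
    (m : ℕ)
    (H : ∀ j i : ℕ, j ≤ i → i + j ≤ m → (Finset.range j).inf (fun k => LinearMap.ker (ψ k j)) ≤
      ((Finset.range j).inf (fun k => LinearMap.ker (ψ k i))).map (ψ j i))
    (j i : ℕ) (hji : j ≤ i) (hij : i + j ≤ m) :
    ((Finset.range j).inf (fun k => LinearMap.ker (ψ k i))).map (ψ j i) =
      (Finset.range j).inf (fun k => LinearMap.ker (ψ k j)) :=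
  le_antisymm (map_inf_ker_le K ψ hcomp j i hji) (H j i hji hij)

/-- DIMENSION COUNT: `Σ_{j ≤ i} dim (⋂_{k<j} ker ψ_{k←j}) = C(m, i)` whenever `2i ≤ m + 1`. -/
theorem sum_finrank_inf_ker_eq [∀ k, FiniteDimensional K (U k)]
    (hcomp : ∀ k t n : ℕ, k ≤ t → t ≤ n → (ψ k t) ∘ₗ (ψ t n) = (((n - k).choose (t - k) : ℕ) : K) • ψ k n)
    (hid : ∀ i : ℕ, ψ i i = LinearMap.id) (m : ℕ)
    (H : ∀ j i : ℕ, j ≤ i → i + j ≤ m → (Finset.range j).inf (fun k => LinearMap.ker (ψ k j)) ≤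
      ((Finset.range j).inf (fun k => LinearMap.ker (ψ k i))).map (ψ j i))
    (hdim : ∀ i : ℕ, i ≤ m → finrank K (U i) = m.choose i) (i : ℕ) (hi : 2 * i ≤ m + 1) :
    ∑ j ∈ Finset.range (i + 1), finrank K ↥((Finset.range j).inf (fun k => LinearMap.ker (ψ k j))) =
      m.choose i := by
  have h := finrank_eq_sum_finrank_map K ψ i (by rw [hid]; exact LinearMap.ker_id) ⊤
  rw [finrank_top, hdim i (by omega)] at h
  rw [h]
  refine Finset.sum_congr rfl (fun j hj => ?_)
  rw [top_inf_eq]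
  rcases (Nat.lt_succ_iff.mp (Finset.mem_range.mp hj)).eq_or_lt with rfl | hlt
  · rw [hid, Submodule.map_id]
  · rw [map_inf_ker_eq K ψ hcomp m H j i hlt.le (by omega)]

/-- THE SPECHT DIMENSIONS: `dim (⋂_{k<j} ker ψ_{k←j}) = C(m, j) − C(m, j − 1)` for `2j ≤ m + 1`
(read `C(m, −1) = 0`). -/
theorem finrank_inf_ker_eq [∀ k, FiniteDimensional K (U k)]
    (hcomp : ∀ k t n : ℕ, k ≤ t → t ≤ n → (ψ k t) ∘ₗ (ψ t n) = (((n - k).choose (t - k) : ℕ) : K) • ψ k n)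
    (hid : ∀ i : ℕ, ψ i i = LinearMap.id) (m : ℕ)
    (H : ∀ j i : ℕ, j ≤ i → i + j ≤ m → (Finset.range j).inf (fun k => LinearMap.ker (ψ k j)) ≤
      ((Finset.range j).inf (fun k => LinearMap.ker (ψ k i))).map (ψ j i))
    (hdim : ∀ i : ℕ, i ≤ m → finrank K (U i) = m.choose i) (j : ℕ) (hj : 2 * j ≤ m + 1) :
    finrank K ↥((Finset.range j).inf (fun k => LinearMap.ker (ψ k j))) =
      m.choose j - if j = 0 then 0 else m.choose (j - 1) := by
  rcases Nat.eq_zero_or_pos j with rfl | hpos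
  · rw [Finset.range_zero, Finset.inf_empty, finrank_top, hdim 0 (Nat.zero_le _), if_pos rfl, Nat.sub_zero]
  · obtain ⟨i, rfl⟩ : ∃ i, j = i + 1 := ⟨j - 1, by omega⟩
    have h1 := sum_finrank_inf_ker_eq K ψ hcomp hid m H hdim (i + 1) hj
    have h2 := sum_finrank_inf_ker_eq K ψ hcomp hid m H hdim i (by omega)
    rw [Finset.sum_range_succ, h2] at h1
    rw [if_neg (Nat.succ_ne_zero i), Nat.add_sub_cancel]
    omega

/-- **WILSON'S RANK FORMULA FOR AN ABSTRACT INCLUSION SYSTEM, FROM THE LIFTING HYPOTHESIS.**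
For `K` of characteristic `p` (a prime or `0`), `t ≤ n`, `t + n ≤ m`:
`dim range ψ_{t←n} = Σ_{j ≤ t, p ∤ C(n−j,t−j)} (C(m,j) − C(m,j−1))`. -/
theorem finrank_range_eq_sum [∀ k, FiniteDimensional K (U k)]
    (hcomp : ∀ k t n : ℕ, k ≤ t → t ≤ n → (ψ k t) ∘ₗ (ψ t n) = (((n - k).choose (t - k) : ℕ) : K) • ψ k n)
    (hid : ∀ i : ℕ, ψ i i = LinearMap.id) (m : ℕ)
    (H : ∀ j i : ℕ, j ≤ i → i + j ≤ m → (Finset.range j).inf (fun k => LinearMap.ker (ψ k j)) ≤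
      ((Finset.range j).inf (fun k => LinearMap.ker (ψ k i))).map (ψ j i))
    (hdim : ∀ i : ℕ, i ≤ m → finrank K (U i) = m.choose i) (p : ℕ) [CharP K p] (t n : ℕ) (htn : t ≤ n)
    (hm : t + n ≤ m) :
    finrank K (LinearMap.range (ψ t n)) = ∑ j ∈ Finset.range (t + 1),
      if p ∣ (n - j).choose (t - j) then 0 else (m.choose j - if j = 0 then 0 else m.choose (j - 1)) := by
  rw [finrank_eq_sum_finrank_map K ψ t (by rw [hid]; exact LinearMap.ker_id) (LinearMap.range (ψ t n))]
  refine Finset.sum_congr rfl (fun j hj => ?_)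
  have hjt : j ≤ t := Nat.lt_succ_iff.mp (Finset.mem_range.mp hj)
  by_cases hdvd : p ∣ (n - j).choose (t - j)
  · rw [if_pos hdvd, map_inf_eq_bot_of_cast_choose_eq_zero K ψ hcomp j t n hjt htn
      ((CharP.cast_eq_zero_iff K p _).mpr hdvd), finrank_bot]
  · rw [if_neg hdvd]
    have h0 : (((n - j).choose (t - j) : ℕ) : K) ≠ 0 := fun h => hdvd ((CharP.cast_eq_zero_iff K p _).mp h)
    rw [← finrank_inf_ker_eq K ψ hcomp hid m H hdim j (by omega)]
    have hle1 := map_inf_ker_le_map_range_inf K ψ hcomp j t n hjt htn h0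
    rw [map_inf_ker_eq K ψ hcomp m H j n (hjt.trans htn) (by omega)] at hle1
    have hle2 : (LinearMap.range (ψ t n) ⊓ (Finset.range j).inf (fun k => LinearMap.ker (ψ k t))).map (ψ j t) ≤
        ((Finset.range j).inf (fun k => LinearMap.ker (ψ k t))).map (ψ j t) := Submodule.map_mono inf_le_right
    rw [map_inf_ker_eq K ψ hcomp m H j t hjt (by omega)] at hle2
    rw [le_antisymm hle2 hle1]

end Abstract

/-! ## Part B — the inclusion matrices `W_{k,n}(α)` form such a system -/

section Concrete

variable (K : Type*) [Field K] {α : Type*} [Fintype α] [DecidableEq α]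

/-- the number of `t`-sets between a `k`-set `S` and a set `V ⊇ S` is `C(#V − k, t − k)` (`k ≤ t`). -/
theorem card_filter_subset_subset (k t : ℕ) (hkt : k ≤ t) (S V : Finset α) (hS : S.card = k)
    (hSV : S ⊆ V) :
    (Finset.univ.filter (fun T : {T : Finset α // T.card = t} => S ⊆ T.1 ∧ T.1 ⊆ V)).card =
      (V.card - k).choose (t - k) := by
  rw [← hS, ← Finset.card_sdiff_of_subset hSV, ← Finset.card_powersetCard (t - S.card) (V \ S)]
  refine Finset.card_bij (fun T _ => T.1 \ S) (fun T hT => ?_) (fun T₁ hT₁ T₂ hT₂ h => ?_) (fun R hR => ?_)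
  · rw [Finset.mem_filter] at hT
    rw [Finset.mem_powersetCard]
    exact ⟨Finset.sdiff_subset_sdiff hT.2.2 (subset_refl S), by rw [Finset.card_sdiff_of_subset hT.2.1, T.2]⟩
  · rw [Finset.mem_filter] at hT₁ hT₂
    apply Subtype.ext
    rw [← Finset.sdiff_union_of_subset hT₁.2.1, ← Finset.sdiff_union_of_subset hT₂.2.1]
    exact congrArg (· ∪ S) h
  · rw [Finset.mem_powersetCard] at hR
    have hdis : Disjoint R S := Finset.disjoint_of_subset_left hR.1 Finset.sdiff_disjoint
    refine ⟨⟨R ∪ S, by rw [Finset.card_union_of_disjoint hdis, hR.2]; omega⟩, ?_, ?_⟩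
    · rw [Finset.mem_filter]
      exact ⟨Finset.mem_univ _, Finset.subset_union_right,
        Finset.union_subset (hR.1.trans Finset.sdiff_subset) hSV⟩
    · change (R ∪ S) \ S = R
      rw [Finset.union_sdiff_right, Finset.sdiff_eq_self_iff_disjoint]
      exact hdis

/-- **WILSON'S IDENTITY (3.1)**: `W_{k,t} · W_{t,n} = C(n − k, t − k) · W_{k,n}` for `k ≤ t`. -/
theorem incl_mul_incl (k t n : ℕ) (hkt : k ≤ t) :
    ((Matrix.of fun (S : {S : Finset α // S.card = k}) (T : {S : Finset α // S.card = t}) =>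
        if S.1 ⊆ T.1 then (1 : K) else 0) *
      (Matrix.of fun (T : {S : Finset α // S.card = t}) (V : {S : Finset α // S.card = n}) =>
        if T.1 ⊆ V.1 then (1 : K) else 0)) =
      (((n - k).choose (t - k) : ℕ) : K) •
      (Matrix.of fun (S : {S : Finset α // S.card = k}) (V : {S : Finset α // S.card = n}) =>
        if S.1 ⊆ V.1 then (1 : K) else 0) := by
  ext S V
  rw [Matrix.mul_apply, Matrix.smul_apply, Matrix.of_apply, smul_eq_mul, mul_ite, mul_one, mul_zero]
  have h : ∀ T : {S : Finset α // S.card = t},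
      (Matrix.of (fun (S : {S : Finset α // S.card = k}) (T : {S : Finset α // S.card = t}) =>
        if S.1 ⊆ T.1 then (1 : K) else 0) S T) *
      (Matrix.of (fun (T : {S : Finset α // S.card = t}) (V : {S : Finset α // S.card = n}) =>
        if T.1 ⊆ V.1 then (1 : K) else 0) T V) = if S.1 ⊆ T.1 ∧ T.1 ⊆ V.1 then 1 else 0 := by
    intro T
    rw [Matrix.of_apply, Matrix.of_apply, ite_and, ite_mul, one_mul, zero_mul]
  rw [Finset.sum_congr rfl (fun T _ => h T), Finset.sum_boole]
  by_cases hSV : S.1 ⊆ V.1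
  · rw [if_pos hSV, card_filter_subset_subset k t hkt S.1 V.1 S.2 hSV, V.2]
  · rw [if_neg hSV, Finset.filter_eq_empty_iff.mpr (fun T _ hT => hSV (hT.1.trans hT.2)), Finset.card_empty,
      Nat.cast_zero]

omit [Fintype α] in
/-- `W_{i,i} = 1`. -/
theorem incl_self_eq_one (i : ℕ) :
    (Matrix.of fun (S : {S : Finset α // S.card = i}) (T : {S : Finset α // S.card = i}) =>
        if S.1 ⊆ T.1 then (1 : K) else 0) = 1 := by
  ext S T
  rw [Matrix.of_apply, Matrix.one_apply]
  by_cases h : S = T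
  · rw [if_pos h, if_pos (h ▸ subset_refl S.1)]
  · rw [if_neg h, if_neg]
    intro hST
    exact h (Subtype.ext (Finset.eq_of_subset_of_card_le hST (by rw [S.2, T.2])))

/-- the composition law of the inclusion system `ψ_{k←i} := W_{k,i}.mulVecLin`. -/
theorem incl_mulVecLin_comp (k t n : ℕ) (hkt : k ≤ t) (htn : t ≤ n) :
    (Matrix.mulVecLin (Matrix.of fun (S : {S : Finset α // S.card = k})
        (T : {S : Finset α // S.card = t}) => if S.1 ⊆ T.1 then (1 : K) else 0)) ∘ₗ
      (Matrix.mulVecLin (Matrix.of fun (T : {S : Finset α // S.card = t})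
        (V : {S : Finset α // S.card = n}) => if T.1 ⊆ V.1 then (1 : K) else 0)) =
      (((n - k).choose (t - k) : ℕ) : K) •
      Matrix.mulVecLin (Matrix.of fun (S : {S : Finset α // S.card = k})
        (V : {S : Finset α // S.card = n}) => if S.1 ⊆ V.1 then (1 : K) else 0) := by
  have _ := htn
  rw [← Matrix.mulVecLin_mul, incl_mul_incl K k t n hkt]
  apply LinearMap.ext
  intro x
  rw [Matrix.mulVecLin_apply, LinearMap.smul_apply, Matrix.mulVecLin_apply, Matrix.smul_mulVec]

/-- the unit law of the inclusion system. -/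
theorem incl_mulVecLin_self (i : ℕ) :
    Matrix.mulVecLin (Matrix.of fun (S : {S : Finset α // S.card = i})
        (T : {S : Finset α // S.card = i}) => if S.1 ⊆ T.1 then (1 : K) else 0) = LinearMap.id := by
  rw [incl_self_eq_one K i, Matrix.mulVecLin_one]

/-- **WILSON'S p-RANK FORMULA FROM THE LIFTING HYPOTHESIS** (`K` of characteristic `p`, a prime or `0`;
`t ≤ n`, `t + n ≤ #α`): `rank_K W_{t,n}(α) = Σ_{j ≤ t : p ∤ C(n−j,t−j)} (C(#α, j) − C(#α, j−1))`, GIVEN that every element of the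
Specht kernel `⋂_{k<j} ker W_{k,j}` lifts into `⋂_{k<j} ker W_{k,i}` along `W_{j,i}` (`j ≤ i`, `i + j ≤ #α`). -/
theorem rank_incl_eq_sum_of_lift
    (H : ∀ j i : ℕ, j ≤ i → i + j ≤ Fintype.card α →
      (Finset.range j).inf (fun k => LinearMap.ker (Matrix.mulVecLin (Matrix.of
        fun (S : {S : Finset α // S.card = k}) (T : {S : Finset α // S.card = j}) =>
          if S.1 ⊆ T.1 then (1 : K) else 0))) ≤
      ((Finset.range j).inf (fun k => LinearMap.ker (Matrix.mulVecLin (Matrix.of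
        fun (S : {S : Finset α // S.card = k}) (T : {S : Finset α // S.card = i}) =>
          if S.1 ⊆ T.1 then (1 : K) else 0)))).map
        (Matrix.mulVecLin (Matrix.of fun (S : {S : Finset α // S.card = j})
          (T : {S : Finset α // S.card = i}) => if S.1 ⊆ T.1 then (1 : K) else 0)))
    (p : ℕ) [CharP K p] (t n : ℕ) (htn : t ≤ n) (hm : t + n ≤ Fintype.card α) :
    (Matrix.of fun (S : {S : Finset α // S.card = t}) (T : {S : Finset α // S.card = n}) =>
        if S.1 ⊆ T.1 then (1 : K) else 0).rank =
      ∑ j ∈ Finset.range (t + 1), if p ∣ (n - j).choose (t - j) then 0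
        else ((Fintype.card α).choose j - if j = 0 then 0 else (Fintype.card α).choose (j - 1)) := by
  rw [Matrix.rank]
  exact finrank_range_eq_sum K (U := fun k => {S : Finset α // S.card = k} → K)
    (fun k i => Matrix.mulVecLin (Matrix.of fun (S : {S : Finset α // S.card = k})
      (T : {S : Finset α // S.card = i}) => if S.1 ⊆ T.1 then (1 : K) else 0))
    (incl_mulVecLin_comp K) (incl_mulVecLin_self K) (Fintype.card α) H
    (fun i _ => by rw [finrank_fintype_fun_eq_card, Fintype.card_finset_len]) p t n htn hm

end Concrete

end Summit.HodgeConjecture.HodgeConjecture.HodgeLocus.Census.InclusionRankFiltration
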